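import Literature.Analysis.FluidPDE.NSBoundedMildWeightedPicard
import Literature.Analysis.FluidPDE.SelfSimilarProofs
import Literature.Analysis.UnboundedOperators.HeatExtensionJointSmooth
import Mathlib.MeasureTheory.Measure.Lebesgue.EqHaar
import HarnessLib

/-!
# KNSS 2009, Remark 4.2: the weighted heat estimate (discharge of `WeightedHeatEstimate`)

Analysis/FluidPDE proof file on the discharge path of the named fact
`Literature.Analysis.FluidPDE.knss2009_local_smoothing` (`NSBoundedMildSmoothing.lean`;
Koch–Nadirashvili–Seregin–Šverák, Acta Math. 203 (2009) = arXiv:0709.3599, §4 p. 8). It proves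
the first of the two estimates of the weighted Picard iteration of
`NSBoundedMildWeightedPicard.lean`, the **weighted heat estimate**
`Literature.Analysis.FluidPDE.WeightedHeatEstimate` (KNSS 2009, Remark 4.2: "Estimate (4.5) says
that the local-in-time smoothing properties of Navier–Stokes for `u₀ ∈ L^∞` are the same as those
of the heat equation", i.e. `‖t^{k/2+l}∇ᵏₓ∂ₜˡ e^{tΔ}u₀‖_∞ ≤ C(k,l)‖u₀‖_∞`), in the isotropic
rescaled form of `ParabolicRescale.lean`: for every order `N` there is `K ≥ 0` such that for
`ν > 0`, `T > 0`, `M ≥ 0` and bounded measurable data `‖a‖ ≤ M`, the free evolution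
`U(t, x) = e^{νtΔ}a(x)` is weighted-smooth on `(0, T) × E` with scale-invariant bounds of orders
`≤ N` by `K M` (`WeightedHeatEstimate_holds`).

## Proof

* **Scale invariance** (`parabolicRescale_heatExtension_of_pos`): the parabolic rescaling of the
  free evolution at scale `t₀` is the free evolution, with unit viscosity, of the rescaled datum,
  `U(t₀θ, √(νt₀)ξ) = e^{θΔ}(a(√(νt₀)·))(ξ)` for `θ > 0` — the Navier–Stokes scaling
  `u(x,t) ↦ λu(λx, λ²t)` of KNSS 2009, §1 (arXiv p. 3) for the heat flow, i.e. the tree's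
  `heatExtension_comp_inv_smul` (`SelfSimilarProofs.lean`: `K(λ²θ, λz) = λ^{-n}K(θ, z)` and the
  Haar change of variables). The rescaled datum is again measurable
  (`Measure.quasiMeasurePreserving_smul`) and bounded by `M`.
* **Unit scale** (Evans, *PDE*, §2.3.1, Thm. 1 (i) and its proof, as vendored in
  `UnboundedOperators/HeatExtensionJointSmooth.lean`): for bounded measurable `b`,
  `(θ, ξ) ↦ e^{θΔ}b(ξ)` is jointly `C^∞` on `(0, ∞) × E` (`contDiffOn_heatExtension_prod`) and
  `‖D^m_{(θ,ξ)} e^{θΔ}b (1, ξ)‖ ≤ C_m ‖b‖_∞` with `C_m` depending only on `m` and `E`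
  (`exists_norm_iteratedFDeriv_heatExtension_prod_le_of_bound` on the time range `[1, 1]`).
* Hence every rescaling of `U` is `C^∞` on `(0, ∞) × E`, so `U` is jointly `C^∞` on the slab
  (`contDiffOn_uncurry_of_parabolicRescale`), its derivatives of order `m` at unit height are
  bounded by `C_m M` uniformly in the scale, and `K_N = ∑_{m ≤ N} C_m` serves every order `≤ N`.

## References

* G. Koch, N. Nadirashvili, G. Seregin, V. Šverák, *Liouville theorems for the Navier–Stokes
  equations and applications*, Acta Math. 203 (2009) 83–105 = arXiv:0709.3599: §1 p. 3 (the
  scaling symmetry), §4 p. 8, Prop. 4.1, (4.5) and Remark 4.2. [KochNadirashviliSereginSverak2009]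
* L. C. Evans, *Partial Differential Equations*, 2nd ed. (2010), §2.3.1, Thm. 1 and its proof
  (derivatives of the fundamental solution are Gaussian-bounded on `t ≥ δ`). [Evans2010]
* Y. Giga, K. Inui, S. Matsui, *On the Cauchy problem for the Navier–Stokes equations with
  nondecaying initial data*, Quad. Mat. 4 (1999) (the weighted norms `sup t^{k/2}‖∇ᵏu(t)‖_∞`).
-/

noncomputable section

open MeasureTheory Set Function Filter Metric Real
open _root_.Topology
open scoped ENNReal NNReal ContDiff

namespace Literature.Analysis.FluidPDE

open UnboundedOperators (heatExtension)

variable {E : Type*} [NormedAddCommGroup E] [InnerProductSpace ℝ E] [FiniteDimensional ℝ E]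
  [MeasurableSpace E] [BorelSpace E]
  {F : Type*} [NormedAddCommGroup F] [NormedSpace ℝ F]

/-! ### The free evolution under the parabolic rescaling -/

/-- **Scale invariance of the free evolution**: for `ν, t₀ > 0` and every datum `a`, the
parabolic rescaling at scale `t₀` of `U(t, x) = e^{νtΔ}a(x)` is, at every point of positive
height `θ`, the unit-viscosity free evolution of the rescaled datum `a(√(νt₀)·)`:
`U(t₀θ, √(νt₀)ξ) = e^{θΔ}(a(√(νt₀)·))(ξ)` (KNSS 2009, §1, arXiv p. 3: the scaling symmetry
`u(x,t) ↦ λu(λx, λ²t)`; for the heat flow this is the homogeneity `K(λ²θ, λz) = λ⁻ⁿK(θ, z)` of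
the Gauss–Weierstrass kernel and the Haar change of variables, `heatExtension_comp_inv_smul`). No
integrability hypothesis is needed. [folklore] -/
theorem parabolicRescale_heatExtension_of_pos {ν t₀ : ℝ} (hν : 0 < ν) (ht₀ : 0 < t₀) (a : E → F)
    {p : ℝ × E} (hp : 0 < p.1) :
    parabolicRescale ν t₀ (fun t x => heatExtension a (ν * t) x) p =
      heatExtension (fun z => a (Real.sqrt (ν * t₀) • z)) p.1 p.2 := by
  have hL0 : 0 < Real.sqrt (ν * t₀) := Real.sqrt_pos.2 (mul_pos hν ht₀)
  have key := heatExtension_comp_inv_smul hL0 (fun z => a (Real.sqrt (ν * t₀) • z)) hp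
    (Real.sqrt (ν * t₀) • p.2)
  simp only [smul_inv_smul₀ hL0.ne', inv_smul_smul₀ hL0.ne'] at key
  rw [Real.sq_sqrt (mul_pos hν ht₀).le] at key
  simp only [parabolicRescale_apply]
  rw [← mul_assoc]
  exact key

/-- The free evolution agrees with the unit-viscosity free evolution of the rescaled datum near
every point of unit height, as functions of the joint variable. [folklore] -/
theorem parabolicRescale_heatExtension_eventuallyEq {ν t₀ : ℝ} (hν : 0 < ν) (ht₀ : 0 < t₀)
    (a : E → F) (ξ : E) :
    parabolicRescale ν t₀ (fun t x => heatExtension a (ν * t) x) =ᶠ[𝓝 ((1 : ℝ), ξ)]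
      fun q : ℝ × E => heatExtension (fun z => a (Real.sqrt (ν * t₀) • z)) q.1 q.2 := by
  filter_upwards [(isOpen_Ioi.prod isOpen_univ).mem_nhds
    (mk_mem_prod (mem_Ioi.2 (one_pos : (0 : ℝ) < 1)) (mem_univ ξ))] with q hq
  exact parabolicRescale_heatExtension_of_pos hν ht₀ a (mem_prod.1 hq).1

/-- **Derivatives at unit height are derivatives of the unit-viscosity evolution of the rescaled
datum**: `D^m (parabolicRescale ν t₀ U)(1, ξ) = D^m_{(θ,ξ)} [e^{θΔ}(a(√(νt₀)·))] (1, ξ)`.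
[folklore] -/
theorem iteratedFDeriv_parabolicRescale_heatExtension {ν t₀ : ℝ} (hν : 0 < ν) (ht₀ : 0 < t₀)
    (a : E → F) (m : ℕ) (ξ : E) :
    iteratedFDeriv ℝ m (parabolicRescale ν t₀ (fun t x => heatExtension a (ν * t) x)) (1, ξ) =
      iteratedFDeriv ℝ m
        (fun q : ℝ × E => heatExtension (fun z => a (Real.sqrt (ν * t₀) • z)) q.1 q.2) (1, ξ) :=
  ((parabolicRescale_heatExtension_eventuallyEq hν ht₀ a ξ).iteratedFDeriv ℝ m).eq_of_nhds

/-- **The rescalings of the free evolution of bounded measurable data are jointly `C^∞` on the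
half-space `(0, ∞) × E`** (Evans, §2.3.1, Thm. 1 (i), for `L^∞` data, transported by the scale
invariance). [folklore] -/
theorem contDiffOn_parabolicRescale_heatExtension {ν t₀ M : ℝ} (hν : 0 < ν) (ht₀ : 0 < t₀)
    {a : E → F} (ha : AEStronglyMeasurable a volume) (haM : ∀ x, ‖a x‖ ≤ M) :
    ContDiffOn ℝ ∞ (parabolicRescale ν t₀ (fun t x => heatExtension a (ν * t) x)) (Ioi 0 ×ˢ univ) := by
  have hL0 : 0 < Real.sqrt (ν * t₀) := Real.sqrt_pos.2 (mul_pos hν ht₀)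
  have hmeas : AEStronglyMeasurable (fun z => a (Real.sqrt (ν * t₀) • z)) volume :=
    ha.comp_quasiMeasurePreserving (Measure.quasiMeasurePreserving_smul volume hL0.ne')
  have hmem : MemLp (fun z => a (Real.sqrt (ν * t₀) • z)) ∞ volume :=
    memLp_top_of_bound hmeas M (Eventually.of_forall fun z => haM _)
  refine (UnboundedOperators.contDiffOn_heatExtension_prod hmem le_top).congr fun q hq => ?_
  exact parabolicRescale_heatExtension_of_pos hν ht₀ a (mem_prod.1 hq).1

/-! ### The discharge -/

variable (E) in
/-- **Discharge of the weighted heat estimate `WeightedHeatEstimate`** (KNSS 2009, Remark 4.2: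
"the local-in-time smoothing properties of Navier–Stokes for `u₀ ∈ L^∞` are the same as those of
the heat equation", i.e. `‖t^{k/2+l}∇ᵏₓ∂ₜˡ e^{tΔ}u₀‖_∞ ≤ C(k,l)‖u₀‖_∞`, the case `u = U` of
Prop. 4.1 / (4.5)): for every order `N` there is `K ≥ 0` such that for `ν > 0`, `T > 0`, `M ≥ 0`
and every measurable datum with `‖a‖ ≤ M`, the free evolution `e^{νtΔ}a` is weighted-smooth on
`(0, T) × E` with scale-invariant bounds of orders `≤ N` by `K M`. Proof: by the scale invariance
(`parabolicRescale_heatExtension_of_pos`) every rescaling is the unit-viscosity evolution of a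
datum bounded by `M`, whose joint derivatives at unit height are bounded by `C_m M` (Evans,
§2.3.1, proof of Thm. 1: `exists_norm_iteratedFDeriv_heatExtension_prod_le_of_bound`);
`K = ∑_{m ≤ N} C_m`. [cite: KochNadirashviliSereginSverak2009, Remark 4.2 and Prop. 4.1 (4.5) (arXiv:0709.3599 p. 8)] -/
theorem WeightedHeatEstimate_holds : WeightedHeatEstimate E := by
  intro N
  choose C hC0 hC using fun m : ℕ =>
    UnboundedOperators.exists_norm_iteratedFDeriv_heatExtension_prod_le_of_bound (E := E) (F := E)
      m (one_pos : (0 : ℝ) < 1) le_rfl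
  refine ⟨∑ m ∈ Finset.range (N + 1), C m, Finset.sum_nonneg fun m _ => hC0 m, ?_⟩
  intro ν T M hν _hT hM a ha haM
  -- the rescaled data `a(√(νt₀)·)` are measurable and bounded by `M`
  have hmeas : ∀ {t₀ : ℝ}, 0 < t₀ →
      AEStronglyMeasurable (fun z => a (Real.sqrt (ν * t₀) • z)) volume := fun ht₀ =>
    ha.comp_quasiMeasurePreserving
      (Measure.quasiMeasurePreserving_smul volume (Real.sqrt_pos.2 (mul_pos hν ht₀)).ne')
  have hbdd : ∀ t₀ : ℝ, ∀ᵐ z ∂(volume : Measure E), ‖a (Real.sqrt (ν * t₀) • z)‖ ≤ M :=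
    fun t₀ => Eventually.of_forall fun z => haM _
  -- the bound `C_m M` at unit height, uniformly in the scale
  have hbound : ∀ {t₀ : ℝ}, 0 < t₀ → ∀ (m : ℕ) (ξ : E),
      ‖iteratedFDeriv ℝ m (parabolicRescale ν t₀ (fun t x => heatExtension a (ν * t) x)) (1, ξ)‖ ≤
        C m * M := by
    intro t₀ ht₀ m ξ
    rw [iteratedFDeriv_parabolicRescale_heatExtension hν ht₀ a m ξ]
    exact hC m (hmeas ht₀) hM (hbdd t₀) 1 ⟨le_rfl, le_rfl⟩ ξ
  refine ⟨⟨?_, fun m => ⟨C m * M, fun t₀ ht₀ ξ => hbound ht₀.1 m ξ⟩⟩, fun t₀ ht₀ m hm ξ => ?_⟩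
  · -- joint smoothness on the slab from the smoothness of the rescalings near unit height
    refine contDiffOn_uncurry_of_parabolicRescale hν fun t₀ ht₀ => ⟨1 / 2, 2, by norm_num, by norm_num, ?_⟩
    exact (contDiffOn_parabolicRescale_heatExtension hν ht₀.1 ha haM).mono
      (prod_mono (Ioo_subset_Ioi_self.trans (Ioi_subset_Ioi (by norm_num))) subset_rfl)
  · refine (hbound ht₀.1 m ξ).trans (mul_le_mul_of_nonneg_right ?_ hM)
    exact Finset.single_le_sum (fun i _ => hC0 i) (Finset.mem_range.2 (Nat.lt_succ_of_le hm))

end Literature.Analysis.FluidPDE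

end
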